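import Summits.QuantumFields.BalabanUV.T4Continuum.Support.NE7K1LinTorusSymbolBloch

/-!
# NE7K1LinTorusLineFourier — row NE7 (node U5), candidate route HOM, path H1L, cell K1-lin(s): NEEDS-ESTIMATE #E1, B-E1 — THE
# DOUBLED-TORUS TWO-CUTOFF LINE IS THE INVERSE DISCRETE FOURIER TRANSFORM OF THE SAMPLES OF THE CONTINUUM MULTIPLIER
# `n²[(1−s)Δ¹ + s·k_L]` (Fourier inversion on the representatives + THEOREM I of file 59)

Lineage `b2b-balaban-t4-ne7-p2` (CRUX PROVER NE7 #2), generation 75; file 60.  File 59 (`NE7K1LinTorusSymbolBloch`) proved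
THEOREM I: `torSymb hn M s y₀ p = ↑(n²[(1−s)Δ¹(θ(p)) + s·k_L(θ(p))])` for every dual index with `|p_μ| < P_μ`.  Lens 2's S-69-1 §6
reads it as «`torLineRep hn M s` = inverse DFT of `p ↦ n²[(1−s)Δ¹(θ(p)) + s·k_L(θ(p))]` (THEOREM I + character orthogonality on
`𝕋_c`)».  THIS FILE types that sentence:

* §1 DUAL CHARACTER ORTHOGONALITY on the representatives: `sum_Ico_rootUnity` (the root-of-unity sum over `Ico 0 P`),
  **`sum_chiT_dual`** `Σ_{p ∈ boxDom P} χ_p(z) = |boxDom P|·[P ∣ z]`, and `dvd_sub_iff_eq_wrap`.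
* §2 **FOURIER INVERSION `apply_eq_inv_fourier`**: a real translation-invariant matrix on `boxDom P` is recovered from its symbol,
  `X(x, y) = |boxDom P|⁻¹·Σ_{p ∈ boxDom P} symbT X y₀ p·χ_p(x − y)`.
* §3 **`torLineRep_eq_inv_fourier`**: for every `s`, mesh `n ≥ 1`, `L ≥ 1`, torus `M` and representatives `x, y`,
  `T^𝕋(s)(x, y) = |𝕋|⁻¹·Σ_{p ∈ boxDom P} n²[(1−s)·Delta1r 0 θ(p) + s·kLr L θ(p)]·χ_p(x − y)`, `P = 2nM`, `θ(p)_μ = 2πp_μ∕P_μ`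
  (the RAW representatives `0 ≤ p_μ < P_μ`; THEOREM I's `|p_μ| < P_μ` covers them) — the torus line IS the finite inverse Fourier
  transform of the samples of ONE torus-independent multiplier, the object files 47–48 certify as strip-regular.

HONEST FRAMING: [folklore] finite Fourier inversion; an identity, no estimate; the match with the ENGINE's normalisation
(`B4TorusKernel.MultiPeriod.torusKernel (descendC …)`: centred representatives `rep`, grid points) is a bookkeeping step left to
the consumer (R-E1); nothing of Bałaban's asserted; no `sorry`.  Census only; NE7 NOT PRINTED ∕ NOT PROVED; spine 0∕9; FIXED FINITE
T⁴, rung (B)+1; NOT infinite volume, NOT mass gap, NOT Clay.  HONEST DEPENDENCY: continuum YM on T⁴ ⇐ BetaPertH ∧ nine spine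
estimates (0/9 proved); BetaPertH ⇐ (D1) ∧ (D4) ∧ CAP+tail; G-an2-4 gates asym, D1 and NE2/3/4.
-/

noncomputable section

open Finset Matrix Complex

namespace Summit.QuantumFields.BalabanUV.T4Continuum.NE7K1LinTorusLineFourier

open Literature.MathematicalPhysics.QuantumFieldTheory.Balaban1983to89
open Literature.MathematicalPhysics.QuantumFieldTheory.Balaban1983to89.B4Reflection242
open Literature.MathematicalPhysics.QuantumFieldTheory.Balaban1983to89.B4Lower18
open Literature.MathematicalPhysics.QuantumFieldTheory.Balaban1983to89.B4TorusPositivity (wrap wrap_wrap_add)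
open Literature.MathematicalPhysics.QuantumFieldTheory.Balaban1983to89.B4Strip (Delta1r)
open NE7K1LinFoldKernels NE7K1LinFoldMatrices NE7K1LinTorusLineSymbol NE7K1LinTorusSymbolReal NE7K1LinTorusFineWaves
open NE7K1LinTorusSymbolBloch NE7K1LinBlochDenominator

variable {d : ℕ}

/-! ### §1 Dual character orthogonality on the representatives -/

/-- `Ico 0 P ⊂ ℤ` is the image of `Fin P`. [folklore] -/
theorem sum_Ico_eq_sum_fin (P : ℕ) (f : ℤ → ℂ) : ∑ j ∈ Finset.Ico (0 : ℤ) P, f j = ∑ t : Fin P, f ((t : ℕ) : ℤ) := by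
  rw [← Finset.sum_range (fun i => f (i : ℤ))]
  have hs : Finset.Ico (0 : ℤ) P = (Finset.range P).image (fun i : ℕ => (i : ℤ)) := by
    ext j
    simp only [Finset.mem_Ico, Finset.mem_image, Finset.mem_range]
    constructor
    · intro h; exact ⟨j.toNat, by omega, by omega⟩
    · rintro ⟨m, hm, rfl⟩; exact ⟨by omega, by omega⟩
  rw [hs, Finset.sum_image (fun a _ b _ h => by exact_mod_cast h)]

/-- the root-of-unity sum over `Ico 0 P`: `Σ_{0 ≤ j < P} e^{2πi·jz∕P} = P·[P ∣ z]`. [folklore] -/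
theorem sum_Ico_rootUnity {P : ℕ} (hP : 1 ≤ P) (z : ℤ) :
    ∑ j ∈ Finset.Ico (0 : ℤ) P, Complex.exp (((j * z : ℤ) : ℂ) / (P : ℂ) * (2 * Real.pi * Complex.I)) =
      if (P : ℤ) ∣ z then (P : ℂ) else 0 := by
  rw [sum_Ico_eq_sum_fin P (fun j => Complex.exp (((j * z : ℤ) : ℂ) / (P : ℂ) * (2 * Real.pi * Complex.I)))]
  exact sum_rootUnity hP z

/-- **DUAL CHARACTER ORTHOGONALITY**: `Σ_{p ∈ boxDom P} χ_p(z) = |boxDom P|` if `P_μ ∣ z_μ` for all `μ`, and `0` otherwise.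
[folklore] -/
theorem sum_chiT_dual {P : Fin (d + 1) → ℕ} (hP : ∀ i, 1 ≤ P i) (z : Fin (d + 1) → ℤ) :
    ∑ p ∈ boxDom P, chiT P p z = if (∀ μ, (P μ : ℤ) ∣ z μ) then ((boxDom P).card : ℂ) else 0 := by
  classical
  simp_rw [chiT_eq_prod]
  rw [boxDom, ← Finset.prod_univ_sum (fun i => Finset.Ico (0 : ℤ) (P i))
    (fun μ j => Complex.exp (((j * z μ : ℤ) : ℂ) / (P μ : ℂ) * (2 * Real.pi * Complex.I)))]
  simp_rw [sum_Ico_rootUnity (hP _)]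
  split_ifs with h
  · rw [Fintype.card_piFinset]
    push_cast
    refine Finset.prod_congr rfl fun μ _ => ?_
    rw [if_pos (h μ), Int.card_Ico, sub_zero, Int.toNat_natCast]
  · obtain ⟨μ, hμ⟩ := not_forall.1 h
    exact Finset.prod_eq_zero (Finset.mem_univ μ) (if_neg hμ)

/-- on the representatives, `P ∣ (y′ − c)` coordinatewise iff `y′ = c mod P`. [folklore] -/
theorem dvd_sub_iff_eq_wrap {P : Fin (d + 1) → ℕ} {y' : Fin (d + 1) → ℤ} (hy' : y' ∈ boxDom P)
    (c : Fin (d + 1) → ℤ) : (∀ μ, (P μ : ℤ) ∣ (y' - c) μ) ↔ y' = wrap P c := by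
  constructor
  · intro h
    rw [← wrap_eq_self hy']
    funext μ
    show y' μ % (P μ : ℤ) = c μ % (P μ : ℤ)
    exact Int.emod_eq_emod_iff_emod_sub_eq_zero.2 (Int.emod_eq_zero_of_dvd (h μ))
  · intro h μ
    rw [h]
    simp only [Pi.sub_apply, wrap]
    exact Dvd.intro (-(c μ / (P μ : ℤ))) (by rw [Int.emod_def]; ring)

/-! ### §2 Fourier inversion for translation-invariant matrices on the representatives -/

/-- **FOURIER INVERSION**: a real translation-invariant matrix on `boxDom P` is the inverse DFT of its symbol:
`X(x, y) = |boxDom P|⁻¹ Σ_{p ∈ boxDom P} symbT X y₀ p · χ_p(x − y)` (any base point `y₀`). [folklore] -/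
theorem apply_eq_inv_fourier {P : Fin (d + 1) → ℕ} (hP : ∀ i, 1 ≤ P i) (X : Matrix ↥(boxDom P) ↥(boxDom P) ℝ)
    (hX : ∀ (v : Fin (d + 1) → ℤ) (x y : ↥(boxDom P)),
      X ⟨wrap P (x.1 + v), wrap_mem_boxDom hP _⟩ ⟨wrap P (y.1 + v), wrap_mem_boxDom hP _⟩ = X x y)
    (y₀ x y : ↥(boxDom P)) :
    (X x y : ℂ) = ((boxDom P).card : ℂ)⁻¹ * ∑ p ∈ boxDom P, symbT P X y₀ p * chiT P p (x.1 - y.1) := by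
  classical
  have hc : ((boxDom P).card : ℂ) ≠ 0 := by
    have : 0 < (boxDom P).card := Finset.card_pos.2 ⟨wrap P 0, wrap_mem_boxDom hP 0⟩
    exact_mod_cast this.ne'
  -- expand the symbol and exchange the sums
  have e1 : ∑ p ∈ boxDom P, symbT P X y₀ p * chiT P p (x.1 - y.1) =
      ∑ y' : ↥(boxDom P), (X y₀ y' : ℂ) * ∑ p ∈ boxDom P, chiT P p (y'.1 - y₀.1 + (x.1 - y.1)) := by
    simp_rw [symbT, Finset.sum_mul, Finset.mul_sum]
    rw [Finset.sum_comm]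
    refine Finset.sum_congr rfl fun y' _ => Finset.sum_congr rfl fun p _ => ?_
    rw [chiT_add]; ring
  rw [e1]
  simp_rw [sum_chiT_dual hP]
  -- only `y' = wrap P (y₀ − x + y)` survives
  set c : Fin (d + 1) → ℤ := y₀.1 - (x.1 - y.1) with hcdef
  have key : ∀ y' : ↥(boxDom P), (∀ μ, (P μ : ℤ) ∣ (y'.1 - y₀.1 + (x.1 - y.1)) μ) ↔ y'.1 = wrap P c := by
    intro y'
    rw [← dvd_sub_iff_eq_wrap y'.2 c]
    have : y'.1 - y₀.1 + (x.1 - y.1) = y'.1 - c := by rw [hcdef]; abel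
    rw [this]
  simp_rw [key]
  rw [Finset.sum_eq_single (⟨wrap P c, wrap_mem_boxDom hP c⟩ : ↥(boxDom P))]
  · simp only [if_true]
    rw [mul_comm, mul_assoc, mul_inv_cancel₀ hc, mul_one]
    -- translation invariance with `v = y₀ − x`
    have h := hX (y₀.1 - x.1) x y
    have e2 : (⟨wrap P (x.1 + (y₀.1 - x.1)), wrap_mem_boxDom hP _⟩ : ↥(boxDom P)) = y₀ :=
      Subtype.ext (by simp only [add_sub_cancel, wrap_eq_self y₀.2])
    have e3 : (⟨wrap P (y.1 + (y₀.1 - x.1)), wrap_mem_boxDom hP _⟩ : ↥(boxDom P)) = ⟨wrap P c, wrap_mem_boxDom hP c⟩ :=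
      Subtype.ext (by simp only [hcdef]; congr 1; abel)
    rw [e2, e3] at h
    rw [h]
  · intro y' _ hy'
    rw [if_neg (fun h => hy' (Subtype.ext h)), mul_zero]
  · intro h; exact absurd (Finset.mem_univ _) h

/-! ### §3 The torus line is the inverse DFT of the samples of the continuum multiplier -/

section Line

variable {n L : ℕ} [NeZero L] {M : Fin (d + 1) → ℕ}

/-- **THE TORUS LINE AS AN INVERSE DFT OF CONTINUUM SAMPLES**: for every `s`, mesh `n ≥ 1`, `L ≥ 1`, torus `M` and
representatives `x, y` of `𝕋 = boxDom (2nM)`: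
`T^𝕋(s)(x, y) = |𝕋|⁻¹·Σ_{p ∈ 𝕋̂} n²[(1−s)·Δ¹(θ(p)) + s·k_L(θ(p))]·χ_p(x − y)`, `θ(p)_μ = 2πp_μ∕P_μ`, the dual indices `p` running
over the raw representatives `boxDom P`. [folklore] -/
theorem torLineRep_eq_inv_fourier (hn : 1 ≤ n) (hM : ∀ i, 1 ≤ M i) (s : ℝ)
    (x y : ↥(boxDom (dbl fun i => n * M i))) :
    (torLineRep (L := L) hn M s x y : ℂ) = ((boxDom (dbl fun i => n * M i)).card : ℂ)⁻¹ *
      ∑ p ∈ boxDom (dbl fun i => n * M i),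
        (((n : ℝ) ^ 2 * ((1 - s) * Delta1r 0 (thetaOf (dbl fun i => n * M i) p) +
          s * kLr L (thetaOf (dbl fun i => n * M i) p)) : ℝ) : ℂ) *
          chiT (dbl fun i => n * M i) p (x.1 - y.1) := by
  have hP := dbl_pos (mul_pos_side hn hM)
  rw [apply_eq_inv_fourier hP (torLineRep (L := L) hn M s) (fun v x' y' => torLineRep_transl hn hM s v x' y') x x y]
  congr 1
  refine Finset.sum_congr rfl fun p hp => ?_
  rw [← torSymb_eq_ofReal hn hM x (fun μ => ?_) s]
  · rfl
  · have h := (mem_boxDom.1 hp) μ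
    rw [abs_lt]; constructor <;> linarith [h.1, h.2]

/-- the same, real parts (the line's entries are real): `T^𝕋(s)(x,y) = |𝕋|⁻¹ Σ_p n²[(1−s)Δ¹ + s·k_L](θ(p))·cos(2π Σ_μ p_μ(x−y)_μ∕P_μ)`
in the form `Re` of the complex identity. [folklore] -/
theorem torLineRep_eq_inv_fourier_re (hn : 1 ≤ n) (hM : ∀ i, 1 ≤ M i) (s : ℝ)
    (x y : ↥(boxDom (dbl fun i => n * M i))) :
    torLineRep (L := L) hn M s x y = (((boxDom (dbl fun i => n * M i)).card : ℂ)⁻¹ *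
      ∑ p ∈ boxDom (dbl fun i => n * M i),
        (((n : ℝ) ^ 2 * ((1 - s) * Delta1r 0 (thetaOf (dbl fun i => n * M i) p) +
          s * kLr L (thetaOf (dbl fun i => n * M i) p)) : ℝ) : ℂ) *
          chiT (dbl fun i => n * M i) p (x.1 - y.1)).re := by
  rw [← torLineRep_eq_inv_fourier hn hM s x y, Complex.ofReal_re]

end Line

end Summit.QuantumFields.BalabanUV.T4Continuum.NE7K1LinTorusLineFourier

end
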